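import Mathlib.Analysis.Meromorphic.Basic
import Mathlib.Analysis.SpecialFunctions.Gamma.Deligne
import Literature.NumberTheory.Automorphic.BaseChangeStrongAllFinite
import Literature.NumberTheory.LFunctions.FiniteEulerProducts
import HarnessLib

/-!
# The twisted standard-`L` package of a weak base-change pair at a place ramified in `E/F`
# (Jacquet–Langlands' method for `GL_n`) — named fact, datum model

Topic `Literature/NumberTheory/Automorphic`; sibling of `BaseChangeStrongAllFinite`
(`ArthurClozel1989_strongLifting_allFinite`, Arthur–Clozel 1989, Ch. 3, Thm. 5.1 at ALL finite
places) and of `StrongArtinGL2OfAutomorphicHalf` (`JacquetLanglands1970_twistedCuspidalPackage`, the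
`GL₂`/Artin instance of the same kind of package).  Wanted by item stmt-Langlands-15194 of route
`SkinnerWilesDefectOne` (`StrongLiftingAllFinite`), whose Summits proof files
(`…StrongLiftingAllFiniteEulerZeros`, `…GlobalQuotient`, `…RamifiedClause`) PROVE the ramified
clause of Thm. 5.1 from this fact.

## Why

The residue of `ArthurClozel1989_strongLifting_allFinite` splits
(`Summit.….strongLiftingAllFinite_iff_unramifiedLift_and_ramified`) into its clause at the places
unramified in `E/F` — reduced in the tree to named leaves
(`ArthurClozel1989_strongLifting_unramified_of_offS`) — and the RAMIFIED CLAUSE (R): at the place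
`w₀` over a place `v₀` of `F` ramified in the cyclic prime-degree `E/F` at which `π` is unramified
with Satake parameter `α`, the cuspidal weak lift `P` has Satake parameter `α`.  Arthur–Clozel
prove (R) (pp. 212–214) by the full twisted trace identity at `v₀` and the local lifting of Ch. 1
§6, none of which the tree can express.  The tree proves the `GL₂`/Artin analogue of such a
statement — Gelbart's Prop. 4.1 — by Jacquet–Langlands' method (LNM 114, proof of Thm. 12.2,
pp. 209–211: `StrongArtinGL2GlobalQuotientProofs`, `…LocalRigidityProofs`), from the named fact
`JacquetLanglands1970_twistedCuspidalPackage` carrying the analytic properties of the twisted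
`L`-functions.  THIS fact is the corresponding package for (R); from it the Summits files prove (R)
by the quotient of the two functional equations and the rigidity of Euler zeros on vertical
progressions, for every `n`, with no trace formula, no archimedean matching and no strong
multiplicity one.

## What is asserted, and its sources

Data: `E/F` Galois of prime degree `ℓ` (cyclic; class-field character `η`), cuspidal data `π`, `P`
on `GL_n(𝔸_F)`, `GL_n(𝔸_E)` with `P` a weak base-change lift of `π` (`IsWeakBaseChangeLiftAE`:
Arthur–Clozel's (1.1) `t_{P,w} = t_{π,u}^{f(w|u)}` off finitely many `w`), a place `w₀ ∣ v₀` with `v₀`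
NOT unramified in `E` — hence totally ramified: `w₀` is the only place above, `f(w₀|v₀) = 1`,
`q_{w₀} = q_{v₀} =: q` (`HeightOneSpectrum.inertiaDeg_eq_one_of_not_isUnramifiedIn`), `η_{v₀}`
ramified (local class field theory) — and a Satake parameter `α` of `π` at `v₀`.  Asserted:

* (genericity) no two entries of `α` have ratio `q`.  The local component `π_{v₀}` of the cuspidal
  `π` is generic (Shalika 1974, Thm. 5.5; Piatetski-Shapiro) and spherical, hence an irreducible
  unramified principal series, and `ind(χ₁, …, χ_n)` is reducible iff some `χᵢ χⱼ⁻¹ = |·|^{±1}`, i.e.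
  iff two Satake entries have ratio `q` (Bernstein–Zelevinsky 1977, Thm. 4.2).
* (Euler data of the lift at `w₀`) `r`, `u : Fin r → ℂ`, `m : Fin r → ℕ` with `u_i ≠ 0`, `m_i ≥ 1`,
  and the SATAKE DICTIONARY "`(∀ i, m_i = 1) → r = n → P` has Satake parameter `{u_i}` at `w₀`".
  The local component `P_{w₀}` of the cuspidal `P` is generic, so `P_{w₀} ≅ Δ₁ × ⋯ × Δ_t` is
  irreducibly induced from segments `Δ = St_m(ρ)` (Zelevinsky 1980, Thm. 9.7); its standard
  `L`-factor is `∏ L(s, Δ)` with `L(s, St_m(ρ)) = L(s + (m-1)/2, ρ)`, equal to `1` unless `ρ = χ|·|^e`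
  is an unramified character of `E_{w₀}^×` twisted by `|·|^e`, when it is `(1 - χ(ϖ) q^{-e-(m-1)/2} q^{-s})⁻¹`
  (Jacquet–Piatetski-Shapiro–Shalika 1983, §§8–9; Jacquet 1979, (1.3)–(1.4); Godement–Jacquet 1972,
  Thm. 3.3): over those segments put `u = χ(ϖ) q^{-e-(m-1)/2}`, so that
  `L(s, P_{w₀}) = ∏_i (1 - u_i q^{-s})⁻¹` and, the contragredient segment being `St_m(χ⁻¹|·|^{-e})`,
  `L(s, P̃_{w₀}) = ∏_i (1 - u_i⁻¹ q^{-(m_i-1)} q^{-s})⁻¹`.  If every such segment has length `1` and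
  there are `n` of them, they exhaust `P_{w₀}`, which is then the irreducible unramified principal
  series `ind(χ₁|·|^{e₁}, …, χ_n|·|^{e_n})` of Satake parameter `{u_i}`; the datum `P` then has Satake
  parameter `{u_i}` at `w₀` (Borel–Jacquet 1979, 4.6; Flath: the spherical Hecke eigenvalues).
* (global analytic data) meromorphic `Λ_π, Λ_P, Λ_π', Λ_P'` on `ℂ`, continuous `ε_π, ε_P` with
  `ε_P` nowhere zero, multisets `μ_π, μ_P, μ_π', μ_P'`, `c ∈ ℝ`, with the two cross-multiplied
  Euler-factor agreements for `re s > c`, the two functional equations for all `s`, and `Λ_π'`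
  non-zero at some point of analyticity.  Take an idèle class character `ω` of `F` with `ω_{v₀} = 1`,
  so ramified at the other exceptional finite places
  `S' = Ram(π) ∪ Ram_F(P) ∪ (Ram(E/F) ∖ {v₀}) ∪ {u : (1.1) fails at some w ∣ u}` that every local
  factor of `π_u ⊗ ω_u η_uⁱ` and of `P_w ⊗ (ω ∘ N_{E/F})_w`, `w ∣ u ∈ S'`, is `1` (Jacquet–Langlands
  1970, Lemma 12.5; `L(s, τ ⊗ χ) = 1` for `χ` sufficiently ramified, loc. cit. JPSS / Jacquet), and
  put `Λ_π(s) = ∏_{i mod ℓ} Λ(s, ω ⊗ π ⊗ ηⁱ)`, `Λ_P(s) = Λ(s, (ω ∘ N) ⊗ P)`,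
  `Λ_π'(s) = ∏_i Λ(s, ω⁻¹ ⊗ π̃ ⊗ η⁻ⁱ)`, `Λ_P'(s) = Λ(s, (ω ∘ N)⁻¹ ⊗ P̃)` — completed standard
  `L`-functions (archimedean factors times finite Euler product, no conductor power): meromorphic on
  `ℂ` with `Λ(s) = W N^{1/2-s} Λ̃(1-s)` (Godement–Jacquet 1972, Thm. 13.8; Jacquet 1979, Thm. (6.2)),
  archimedean factors products of `Γ_ℝ(s + μ)` (Godement–Jacquet §8; `Γ_ℂ(s) = Γ_ℝ(s)Γ_ℝ(s+1)`),
  absolutely convergent and non-zero for `re s ≫ 0` (Jacquet–Shalika 1981, Thm. 5.3).  The Euler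
  factors of `Λ_π` and `Λ_P` AGREE off `v₀, ∞`: at `u ∈ S'` all are `1`; at the other finite
  `u ≠ v₀` (unramified in `E`; `π_u`, the `P_w` unramified with (1.1) at every `w ∣ u`;
  `(ω ∘ N)_w(ϖ_w) = ω_u(ϖ_u)^{f_u}`; if `ω_u` is ramified both sides are `1`) by the local computation
  `∏_{i mod ℓ}(1 - a ζ_uⁱ T) = (1 - a^{f_u} T^{f_u})^{ℓ/f_u}`, `ζ_u = η_u(ϖ_u)` (Arthur–Clozel 1989,
  Ch. 3, proof of Thm. 3.1 and Lemma 4.3; the tree's `prod_range_eulerPolynomial_map_mul`).  At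
  `v₀` the `π`-side factor is `∏_{a ∈ α}(1 - a q^{-s})⁻¹` (`ω_{v₀} = 1`; `L(s, π_{v₀} ⊗ η_{v₀}ⁱ) = 1` for
  `i ≠ 0`) and the `P`-side factor the displayed JPSS factor; same for the contragredients (`π̃` has
  Satake parameter `α⁻¹`).  Moving the reciprocal `v₀`-factors and the reciprocal archimedean
  factors across gives the two displayed identities.

Nothing here asserts the CONCLUSION of Thm. 5.1 (the Satake parameter of `P` at `w₀`): the only
Satake statement about `P` is the dictionary clause, conditional on the spherical shape of the
Euler data; that this shape is forced — and `α = {u_i}` — is the PROVED content of the Summits files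
(`ramifiedClause_of_package`).

## Faithfulness notes

* "`E/F` cyclic of prime degree" is `[IsGalois F E]`, `(Module.finrank F E).Prime`; "`w₀ ∣ v₀`" is
  `w.asIdeal.under (𝓞 F) = v.asIdeal`; "`v₀` ramified in `E`" is `¬ Algebra.IsUnramifiedIn`, exactly
  as in the sibling facts.  The `P`-side Euler terms are at `w.residueCard = q_{w₀}` (`= q_{v₀}`).
* Unitarity.  The tree's cuspidal data are `π⁰ ⊗ |det|^s`, `π⁰` unitary cuspidal; every clause is
  stable under such twists (segments, genericity, functional equations with shifted critical strip;
  `c` is existential), as for the siblings.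
* Mathlib-`Meromorphic` functions carry junk values on a discrete set; the functional equations are
  asserted pointwise for suitable representatives (define `Λ_π := ε_π · Λ_π'(1 - ·)` from the
  continued `Λ_π'`; on `re s > c` no pole of `Λ_π'(1 - ·)` occurs by the functional equation
  itself), verbatim the format of `JacquetLanglands1970_twistedCuspidalPackage` and of
  `frobSatake_of_meromorphic_functional_equations`.
* `n = 0`: trivially true (all `Λ = 1`, `r = 0`; the dictionary is `hasSatakeParamAt_rank_zero`).

Discharge status: OPEN — L/XL but standard (Godement–Jacquet theory is largely in the tree:
`godementJacquet_hasMeromorphicContinuation_holds`; the local JPSS factor of a generic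
representation and Jacquet–Langlands' Lemma 12.5 are not).  No non-vacuity `example` can be given
(no automorphic representation is constructible in the tree).

## References

* H. Jacquet, I. I. Piatetski-Shapiro, J. A. Shalika, *Rankin–Selberg convolutions*, Amer. J. Math.
  105 (1983), §§8–9. [JPSS1983]
* R. Godement, H. Jacquet, *Zeta functions of simple algebras*, LNM 260 (1972), Thm. 3.3, §8,
  Thm. 13.8. [GodementJacquet1972]
* H. Jacquet, *Principal `L`-functions of the linear group*, Corvallis (1979), Part 2, (1.3)–(1.4),
  Thm. (6.2). [JacquetCorvallis1979]
* J. A. Shalika, *The multiplicity one theorem for `GL_n`*, Ann. of Math. 100 (1974), Thm. 5.5.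
  [Shalika1974]
* I. N. Bernstein, A. V. Zelevinsky, Ann. Sci. ÉNS 10 (1977), Thm. 4.2 [BernsteinZelevinsky1977];
  A. V. Zelevinsky, Ann. Sci. ÉNS 13 (1980), Thm. 9.7. [Zelevinsky1980]
* H. Jacquet, R. P. Langlands, *Automorphic Forms on GL(2)*, LNM 114 (1970), Lemma 12.5, proof of
  Thm. 12.2, pp. 209–211. [JacquetLanglands1970]
* H. Jacquet, J. A. Shalika, Amer. J. Math. 103 (1981), Thm. 5.3. [JacquetShalikaAJM1981]
* J. Arthur, L. Clozel, Ann. of Math. Stud. 120 (1989), Ch. 3, §1 (1.1), proof of Thm. 3.1,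
  Lemma 4.3, Thm. 5.1. [ArthurClozelAMS120]
* A. Borel, H. Jacquet, Corvallis (1979), §4.6. [BorelJacquetCorvallis1979]

## Mathlib / tree search

`lean search 'twistedStandardLPackage|twistedCuspidalPackage|ramifiedClause'`: only the `GL₂`
package `JacquetLanglands1970_twistedCuspidalPackage` (`StrongArtinGL2OfAutomorphicHalf`) and the
Summits proof files of stmt-Langlands-15194.  Reused: `IsWeakBaseChangeLiftAE`,
`CuspidalAutomorphicRepData`, `AutomorphicRepData.HasSatakeParamAt`, `LFunctions.eulerTerm`,
`HeightOneSpectrum.residueCard`, Mathlib `Meromorphic`, `Complex.Gammaℝ`.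
-/

noncomputable section

open scoped NumberField
open NumberField IsDedekindDomain Complex
open Literature.NumberTheory.LFunctions

namespace Literature.NumberTheory.Automorphic

/-- **The twisted standard-`L` package of a weak base-change pair at a place ramified in `E/F`**
(named fact, D-0014; the `GL_n` base-change analogue of `JacquetLanglands1970_twistedCuspidalPackage`).
For `E/F` Galois of prime degree, cuspidal `π`, `P` on `GL_n(𝔸_F)`, `GL_n(𝔸_E)` with `P` a weak
base-change lift of `π`, `w ∣ v` with `v` NOT unramified in `E` (`f(w|v) = 1`, `q_w = q_v = q`) and
`α` a Satake parameter of `π` at `v`: (genericity of the spherical generic `π_v`) no two entries of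
`α` have ratio `q` (Shalika 1974, Thm. 5.5; Bernstein–Zelevinsky 1977, Thm. 4.2); and there are the
Jacquet–Piatetski-Shapiro–Shalika Euler data `(u_i, m_i)_{i<r}` of the generic `P_w` —
`L(s, P_w)⁻¹ = ∏_i (1 - u_i q^{-s})`, `L(s, P̃_w)⁻¹ = ∏_i (1 - u_i⁻¹ q^{-(m_i-1)} q^{-s})` over its segments
`St_{m_i}(χ_i|·|^{e_i})` with `χ_i` unramified, `u_i = χ_i(ϖ) q^{-e_i-(m_i-1)/2}` (JPSS 1983 §§8–9;
Jacquet 1979 (1.3)–(1.4); Zelevinsky 1980, Thm. 9.7) — with the Satake dictionary (all `m_i = 1`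
and `r = n` ⇒ `P` has Satake parameter `{u_i}` at `w`; Borel–Jacquet 4.6), and, for an idèle class
character `ω` of `F` with `ω_v = 1` killing the other exceptional places (Jacquet–Langlands 1970,
Lemma 12.5), the completed twisted standard `L`-functions `Λ_π = ∏_{i mod ℓ} Λ(·, ω ⊗ π ⊗ ηⁱ)`,
`Λ_P = Λ(·, (ω ∘ N) ⊗ P)` and their contragredient partners: MEROMORPHIC on `ℂ` with functional
equations `Λ_π(s) = ε_π(s) Λ_π'(1 - s)`, `Λ_P(s) = ε_P(s) Λ_P'(1 - s)` (`ε` continuous, `ε_P` nowhere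
zero; Godement–Jacquet 1972, Thm. 13.8; Jacquet 1979, Thm. (6.2)), archimedean factors
`∏ Γ_ℝ(s + μ)` (Godement–Jacquet §8), Euler factors agreeing off `v, ∞` for `re s > c`
(Arthur–Clozel 1989, Ch. 3, Lemma 4.3 computation at the unramified places; all factors `1` at the
exceptional ones) — in the cross-multiplied form displayed, the `v`-factors being
`∏_{a ∈ α}(1 - a q^{-s})` (`η_v` ramified) and the JPSS factors — and `Λ_π'` non-zero at some point
of analyticity (Jacquet–Shalika 1981, Thm. 5.3).  See the module docstring for every clause.
[cite: JPSS1983, §§8–9] [cite: GodementJacquet1972, Thm. 13.8 and §8]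
[cite: JacquetCorvallis1979, (1.3)–(1.4) and Thm. (6.2)] [cite: Shalika1974, Thm. 5.5]
[cite: BernsteinZelevinsky1977, Thm. 4.2] [cite: Zelevinsky1980, Thm. 9.7]
[cite: JacquetLanglands1970, Lemma 12.5 and proof of Thm. 12.2, pp. 209–211]
[cite: JacquetShalikaAJM1981, Thm. 5.3] [cite: ArthurClozelAMS120, Ch. 3 §1 (1.1), proof of Thm. 3.1, Lemma 4.3]
[cite: BorelJacquetCorvallis1979, 4.6] -/
def JPSS1983_twistedStandardLPackage_weakBaseChange : Prop :=
  ∀ (n : ℕ) (F E : Type) [Field F] [NumberField F] [Field E] [NumberField E] [Algebra F E]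
    [IsGalois F E], (Module.finrank F E).Prime →
    ∀ (hF : isCompact_glFiniteIntegralLevel n F) (hE : isCompact_glFiniteIntegralLevel n E)
      (π : CuspidalAutomorphicRepData n F hF) (P : CuspidalAutomorphicRepData n E hE),
      IsWeakBaseChangeLiftAE π.1 P.1 →
      ∀ (w : HeightOneSpectrum (𝓞 E)) (v : HeightOneSpectrum (𝓞 F)) (α : Multiset ℂ),
        w.asIdeal.under (𝓞 F) = v.asIdeal → ¬ Algebra.IsUnramifiedIn (𝓞 E) v.asIdeal →
        π.1.HasSatakeParamAt v α →
        (∀ a ∈ α, ∀ b ∈ α, b ≠ (v.residueCard : ℂ) * a) ∧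
        ∃ (r : ℕ) (u : Fin r → ℂ) (m : Fin r → ℕ) (Λπ ΛP Λπ' ΛP' επ εP : ℂ → ℂ)
          (μπ μP μπ' μP' : Multiset ℂ) (c : ℝ),
          (∀ i, u i ≠ 0) ∧ (∀ i, 1 ≤ m i) ∧
          ((∀ i, m i = 1) → r = n → P.1.HasSatakeParamAt w (∑ i, ({u i} : Multiset ℂ))) ∧
          Meromorphic Λπ ∧ Meromorphic ΛP ∧ Meromorphic Λπ' ∧ Meromorphic ΛP' ∧
          Continuous επ ∧ Continuous εP ∧ (∀ s, εP s ≠ 0) ∧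
          (∀ s : ℂ, c < s.re →
            Λπ s * ((α.map fun a => eulerTerm v.residueCard a s).prod *
                (μπ.map fun x => (Gammaℝ (s + x))⁻¹).prod) =
              ΛP s * ((∏ i, eulerTerm w.residueCard (u i) s) *
                (μP.map fun x => (Gammaℝ (s + x))⁻¹).prod)) ∧
          (∀ s : ℂ, c < s.re →
            Λπ' s * ((α.map fun a => eulerTerm v.residueCard a⁻¹ s).prod *
                (μπ'.map fun x => (Gammaℝ (s + x))⁻¹).prod) =
              ΛP' s * ((∏ i, eulerTerm w.residueCard
                  ((u i)⁻¹ * ((w.residueCard : ℂ)⁻¹) ^ (m i - 1)) s) *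
                (μP'.map fun x => (Gammaℝ (s + x))⁻¹).prod)) ∧
          (∀ s, Λπ s = επ s * Λπ' (1 - s)) ∧ (∀ s, ΛP s = εP s * ΛP' (1 - s)) ∧
          (∃ s, AnalyticAt ℂ Λπ' s ∧ Λπ' s ≠ 0)

end Literature.NumberTheory.Automorphic

end
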